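import Mathlib
import HarnessLib
import Summits.HubbardSuperconductivity.HubbardSuperconductivity.Theorems.KLProgrammeKLRegimeEnginePairTransferOutClassForwardCrossedQuarter
import Summits.HubbardSuperconductivity.HubbardSuperconductivity.Theorems.KLProgrammeKLRegimeEnginePairTransferOutClassForwardQuarterSplit3

/-!
# Route `KLProgramme` — ENGINE item stmt-HubbardSuperconductivity-20437 `KLRegimeEngineV17F2`, stub (c) value lane «(c)-OUT» × located-risk #9 «ZS-L1»: the forward-window
# CROSSED member line with a quarter thermal share UNDER THE THREE-WAY KERNEL SPLIT `V_j⊗V_j = c₀ + F₁ + F₂` (cell gate-hubbard-kl, seat hubbard-kl-k3c2-p2 g21)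

WHY.  Crossed twin of …OutClassForwardQuarterSplit3: `forward_member_crossed_row_le_quarter` (g18) with the signed row replaced by `member_crossed_signed_le_split3`
(…PairTransferMemberSplit3).  The slots are the same — `(Klam U)²·klEngGeo11.phGain (n+1) |p_{x+y−Qm}| + thermalBar/4 + 2·LAT/L + ε₁·2048·15367` at
`(A₀, L_A, ε) := (2‖c₀‖ + A₁, L₁, ε₁)` (the constant part booked with data `2‖c₀‖`, uniform with the direct line) (`klmsRowBound_add`) — plus the decaying window entry `A₂·4096·15381·(ρw/π + 1/L)` (`window_flat_le_base` at `C = 256/3`).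
* **`forward_member_crossed_row_le_quarter_split3`**.
Composition/arithmetic over landed rows; the split and its data are binders; nothing asserts (E2″-F), (c), K3 or superconductivity.  0 kit · 0 lit.
-/

noncomputable section

namespace Summit.HubbardSuperconductivity.HubbardSuperconductivity.Theorems.KLRegimeSplit

set_option linter.dupNamespace false -- summit = problem name (single-conjunct summit), D-0017

open Real Set Finset Complex Literature.MathematicalPhysics.QuantumLattice
open Literature.Probability.LatticeModels hiding torusSupNorm
open Literature.MathematicalPhysics.QuantumLattice.BandSectorCounting
open Summit.HubbardSuperconductivity.HubbardSuperconductivity.Theorems.KLProgrammeLegKernels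
open Summit.HubbardSuperconductivity.HubbardSuperconductivity.Theorems.KLRegimeWick
open Summit.HubbardSuperconductivity.HubbardSuperconductivity.Theorems.TwoPointAssembly
open Summit.HubbardSuperconductivity.HubbardSuperconductivity.Theorems.EngineV8
open Summit.HubbardSuperconductivity.HubbardSuperconductivity.Theorems.DispersionFlow
open Summit.HubbardSuperconductivity.HubbardSuperconductivity.Theorems.PerturbedFermiCurve

section Model

variable {L M : ℕ} [NeZero L] [NeZero M] {a' b' : ℝ} (B : BandBounds a' b') {R : RenConsts} {U μ : ℝ} {N : ℕ} {K : TrigPolyC4v} {A : ℝ}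

/-- **MEMBER CROSSED ROW, THREE-WAY SPLIT, constant part booked with data `(2‖c‖, 0, 0)`** (uniform with the direct line; otherwise = `member_crossed_signed_le_split3`):
`F₁` with data `(A₁, L₁, ε₁)`, `F₂` of sup `A₂` supported in `|k − cen|_𝕋 ≤ ρ` ⟹ `‖S_{Φ,x}‖ ≤ c-row + (F₁-row + ε₁·flat) +
A₂·(256/3)(βL²)²/Λ(t)²·(2·(15381(ρ/π + 1/L)·Λₙ·βL²))`. -/
theorem member_crossed_signed_le_split3_two {β : ℝ} (hR : ∀ j, 0 ≤ R.Gfr j) (hK : FrameOK R U N μ K)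
    (hAb : ∀ p : Momentum, ∀ j ≤ 2, ‖iteratedFDeriv ℝ j (frameShift K) p‖ ≤ A) (hA : 4 * A < B.Dtmin) (hA20 : 4 * A ≤ 1 / 20) (hμ : μ ≤ -0.15)
    (n : ℕ) {t : ℝ} (ht : t ∈ Icc (0 : ℝ) 1) (hβ : klBetaMin ≤ β) (hβL : β ≤ L) (hn : n + 1 ≤ nScales β + 1) (hβn : 16 * π / β ≤ klScale klE0 (n + 1))
    (hM : β * (4 * klScale klE0 (n + 1)) / (2 * Real.pi) + 1 ≤ M)
    (Φ : ℕ → ℝ → FreqMomentum L M → ℝ) (hΦ : Φ = fun j t k => (softSymbolCompl L M β μ K (n + 1) j) k + (hubbardCutoffWeightCT L M β μ K (klScale klE0 (n + 1)) k -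
            hubbardCutoffWeightCT L M β μ K (klScale klE0 n + t * (klScale klE0 (n + 1) - klScale klE0 n)) k))
    (Wd : ℝ → FreqMomentum L M → ℝ) (hWd : Wd = fun t k => deriv (fun Λ' : ℝ => hubbardCutoffWeightCT L M β μ K Λ' k) (klScale klE0 n + t * (klScale klE0 (n + 1) - klScale klE0 n)))
    (V : ℕ → ℝ → (Fin 4 → HubbardFieldIdx L M) → ℂ) {j : ℕ} (hj : n + 1 ≤ j) (Qm x y : TorusSite 2 L)
    (hlo : a' < μ - 4 * klScale klE0 (n + 1) - 4 * A) (hhi : μ + 4 * klScale klE0 (n + 1) + 4 * A < b')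
    (hq : (4 + 8 / 3 * R.Gfr 1 * U ^ 2) * klTorusNorm L (Qm - x - y) ≤ klScale klE0 (n + 1) / 8)
    (c : ℂ) (F₁ F₂ : FreqMomentum L M → FreqMomentum L M → ℂ) (F₁₀ : TorusSite 2 L → TorusSite 2 L → ℂ)
    (hsplit : ∀ (p p' : FreqMomentum L M),
      V j t ![((p, 0), 1), ((p', 1), 0), (((omega0 M, y), 0), 0), ((((omega0 M).rev, Qm - x), 1), 1)] *
          V j t ![((p, 0), 0), ((p', 1), 1), ((((omega0 M).rev, Qm - y), 1), 0), (((omega0 M, x), 0), 1)] = c + F₁ p p' + F₂ p p')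
    {A₁ L₁ ε₁ : ℝ} (hA1 : 0 ≤ A₁) (hL1 : 0 ≤ L₁) (hε1 : 0 ≤ ε₁)
    (hY0B₁ : ∀ k : TorusSite 2 L, ‖F₁₀ k (k + (Qm - x - y))‖ ≤ A₁)
    (hY1B₁ : ∀ k k' : TorusSite 2 L, ‖F₁₀ k (k + (Qm - x - y)) - F₁₀ k' (k' + (Qm - x - y))‖ ≤ L₁ * klTorusNorm L (k - k'))
    (hY0A₁ : ∀ k : TorusSite 2 L, ‖F₁₀ (k + -(Qm - x - y)) k‖ ≤ A₁)
    (hY1A₁ : ∀ k k' : TorusSite 2 L, ‖F₁₀ (k + -(Qm - x - y)) k - F₁₀ (k' + -(Qm - x - y)) k'‖ ≤ L₁ * klTorusNorm L (k - k'))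
    (hflat₁ : ∀ (i i' : MatsubaraIdx M) (k k' : TorusSite 2 L), matsubaraInt M i' + 1 = matsubaraInt M i →
      matsubaraFreq β M i ^ 2 ≤ (5 * klScale klE0 (n + 1)) ^ 2 → ‖F₁ (i, k) (i', k') - F₁₀ k k'‖ ≤ ε₁)
    (cen : TorusSite 2 L) {ρ A₂ : ℝ} (hρ : 0 ≤ ρ) (hA2 : 0 ≤ A₂)
    (hF₂ : ∀ (p p' : FreqMomentum L M), ‖F₂ p p'‖ ≤ A₂)
    (hsupp₂ : ∀ (p p' : FreqMomentum L M), ρ < klTorusNorm L (p.2 - cen) → F₂ p p' = 0) :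
    ‖∑ p : FreqMomentum L M, ∑ p' : FreqMomentum L M,
        if matsubaraInt M p'.1 + matsubaraInt M (omega0 M) + matsubaraInt M (omega0 M) + 1 = matsubaraInt M p.1 ∧ p'.2 = p.2 + Qm - x - y then
          ((((((Φ j t p) : ℝ) : ℂ) * (((β * (L : ℝ) ^ 2 : ℝ) : ℂ) * propCT L M β μ K p)) * ((((Wd t p') : ℝ) : ℂ) * (((β * (L : ℝ) ^ 2 : ℝ) : ℂ) * propCT L M β μ K p'))) +
              (((((Wd t p) : ℝ) : ℂ) * (((β * (L : ℝ) ^ 2 : ℝ) : ℂ) * propCT L M β μ K p)) * ((((Φ j t p') : ℝ) : ℂ) * (((β * (L : ℝ) ^ 2 : ℝ) : ℂ) * propCT L M β μ K p')))) *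
            (V j t ![((p, 0), 1), ((p', 1), 0), (((omega0 M, y), 0), 0), ((((omega0 M).rev, Qm - x), 1), 1)] *
              V j t ![((p, 0), 0), ((p', 1), 1), ((((omega0 M).rev, Qm - y), 1), 0), (((omega0 M, x), 0), 1)])
        else 0‖ ≤
      (β * (L : ℝ) ^ 2) ^ 2 *
          (β * (L : ℝ) ^ 2 * klmsRowBound B.Dtmin A (4 + 8 / 3 * R.Gfr 1 * U ^ 2) (2 * ‖c‖) 0 β n j
              (|-(2 * π / β)| + (4 + 8 / 3 * R.Gfr 1 * U ^ 2) * klTorusNorm L (Qm - x - y)) L +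
            β * (L : ℝ) ^ 2 * klmsRowBound B.Dtmin A (4 + 8 / 3 * R.Gfr 1 * U ^ 2) (2 * ‖c‖) 0 β n j
              (|2 * π / β| + (4 + 8 / 3 * R.Gfr 1 * U ^ 2) * klTorusNorm L (Qm - x - y)) L) +
      ((β * (L : ℝ) ^ 2) ^ 2 *
          (β * (L : ℝ) ^ 2 * klmsRowBound B.Dtmin A (4 + 8 / 3 * R.Gfr 1 * U ^ 2) A₁ L₁ β n j
              (|-(2 * π / β)| + (4 + 8 / 3 * R.Gfr 1 * U ^ 2) * klTorusNorm L (Qm - x - y)) L +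
            β * (L : ℝ) ^ 2 * klmsRowBound B.Dtmin A (4 + 8 / 3 * R.Gfr 1 * U ^ 2) A₁ L₁ β n j
              (|2 * π / β| + (4 + 8 / 3 * R.Gfr 1 * U ^ 2) * klTorusNorm L (Qm - x - y)) L) +
        ε₁ * (256 / 3 * (β * (L : ℝ) ^ 2) ^ 2 / (klScale klE0 n + t * (klScale klE0 (n + 1) - klScale klE0 n)) ^ 2 *
          ∑ p : FreqMomentum L M, |Φ j t p| * ‖propCT L M β μ K p‖)) +
      A₂ * (256 / 3 * (β * (L : ℝ) ^ 2) ^ 2 / (klScale klE0 n + t * (klScale klE0 (n + 1) - klScale klE0 n)) ^ 2 *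
        (2 * (15381 * (ρ / π + ((L : ℝ))⁻¹) * klScale klE0 n * β * (L : ℝ) ^ 2))) := by
  -- (1) split the kernel twice
  set P : FreqMomentum L M → FreqMomentum L M → Prop := fun p p' =>
    matsubaraInt M p'.1 + matsubaraInt M (omega0 M) + matsubaraInt M (omega0 M) + 1 = matsubaraInt M p.1 ∧ p'.2 = p.2 + Qm - x - y with hP
  set ln : FreqMomentum L M → FreqMomentum L M → ℂ := fun p p' =>
    (((((Φ j t p) : ℝ) : ℂ) * (((β * (L : ℝ) ^ 2 : ℝ) : ℂ) * propCT L M β μ K p)) * ((((Wd t p') : ℝ) : ℂ) * (((β * (L : ℝ) ^ 2 : ℝ) : ℂ) * propCT L M β μ K p'))) +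
      (((((Wd t p) : ℝ) : ℂ) * (((β * (L : ℝ) ^ 2 : ℝ) : ℂ) * propCT L M β μ K p)) * ((((Φ j t p') : ℝ) : ℂ) * (((β * (L : ℝ) ^ 2 : ℝ) : ℂ) * propCT L M β μ K p'))) with hln
  have e := ((pinned_crossed_sum_kernel_congr P ln hsplit).trans (pinned_crossed_sum_kernel_add P ln (fun p p' => c + F₁ p p') F₂)).trans
    (congrArg (· + _) (pinned_crossed_sum_kernel_add P ln (fun _ _ => c) F₁))
  simp only [hP, hln] at e
  rw [e]
  -- (2) the three rows
  have hc := klms_member_crossed_signed_le_gen β μ K B hR hK hAb hA hA20 hμ n ht hβ hn hβn hM Φ hΦ Wd hWd hj Qm x y hlo hhi hq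
    (fun _ _ => c) (fun _ _ => c) (A₀ := 2 * ‖c‖) (LA := 0) (ε := 0) (by positivity) le_rfl le_rfl
    (fun k => by show ‖c‖ ≤ 2 * ‖c‖; linarith [norm_nonneg c]) (fun k k' => by simp)
    (fun k => by show ‖c‖ ≤ 2 * ‖c‖; linarith [norm_nonneg c]) (fun k k' => by simp) (fun i i' k k' _ _ => by simp)
  rw [zero_mul, add_zero] at hc
  have h1 := klms_member_crossed_signed_le_gen β μ K B hR hK hAb hA hA20 hμ n ht hβ hn hβn hM Φ hΦ Wd hWd hj Qm x y hlo hhi hq F₁ F₁₀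
    hA1 hL1 hε1 hY0B₁ hY1B₁ hY0A₁ hY1A₁ hflat₁
  have hw : ∀ k : FreqMomentum L M, 0 ≤ Φ j t k ∧ Φ j t k ≤ 1 - hubbardCutoffWeightCT L M β μ K (klScale klE0 n) k := fun k => by
    rw [hΦ]; exact klmf_runningSymbol_mem L M β μ K n (isSoftSymbol_compl β μ K hj).1 ht k
  have h2 := klms_weighted_crossed_norm_le_of_support_soft β μ K hK hβ hβL n n ht hw Wd hWd F₂ Qm x y cen hρ hA2 hF₂ hsupp₂
  exact (norm_add_le _ _).trans (add_le_add ((norm_add_le _ _).trans (add_le_add hc h1)) h2)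


/-- **THE FORWARD-WINDOW CROSSED MEMBER LINE, QUARTER THERMAL SHARE, THREE-WAY KERNEL SPLIT** `V_j⊗V_j = c₀ + F₁ + F₂` (located-risk #9 «ZS-L1»): sizes and
lattice term at `(A₀, L_A, ε) := (2‖c₀‖ + A₁, L₁, ε₁)` (the constant part booked with data `2‖c₀‖`, uniform with the direct line), plus the decaying window entry `A₂·4096·15381·(ρw/π + 1/L)`. -/
theorem forward_member_crossed_row_le_quarter_split3 (hR : ∀ j, 0 ≤ R.Gfr j) (hK : FrameOK R U N μ K)
    (hAb : ∀ p : Momentum, ∀ j ≤ 2, ‖iteratedFDeriv ℝ j (frameShift K) p‖ ≤ A) (hA : 4 * A < B.Dtmin) (hA20 : 4 * A ≤ 1 / 20) (hμ : μ ≤ -0.15)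
    (n : ℕ) {t : ℝ} (ht : t ∈ Icc (0 : ℝ) 1) {β : ℝ} (hβ : klBetaMin ≤ β) (hn : n + 1 ≤ nScales β + 1) (hβn : 16 * π / β ≤ klScale klE0 (n + 1))
    (hM : β * (4 * klScale klE0 (n + 1)) / (2 * Real.pi) + 1 ≤ M)
    (Φ : ℕ → ℝ → FreqMomentum L M → ℝ) (hΦ : Φ = fun j t k => (softSymbolCompl L M β μ K (n + 1) j) k + (hubbardCutoffWeightCT L M β μ K (klScale klE0 (n + 1)) k -
            hubbardCutoffWeightCT L M β μ K (klScale klE0 n + t * (klScale klE0 (n + 1) - klScale klE0 n)) k))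
    (Wd : ℝ → FreqMomentum L M → ℝ) (hWd : Wd = fun t k => deriv (fun Λ' : ℝ => hubbardCutoffWeightCT L M β μ K Λ' k) (klScale klE0 n + t * (klScale klE0 (n + 1) - klScale klE0 n)))
    (V : ℕ → ℝ → (Fin 4 → HubbardFieldIdx L M) → ℂ) {j : ℕ} (hj : n + 1 ≤ j) (Qm x y : TorusSite 2 L)
    (hlo : a' < μ - 4 * klScale klE0 (n + 1) - 4 * A) (hhi : μ + 4 * klScale klE0 (n + 1) + 4 * A < b')
    (hq : (4 + 8 / 3 * R.Gfr 1 * U ^ 2) * klTorusNorm L (Qm - x - y) ≤ klScale klE0 (n + 1) / 8)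
    (c₀ : ℂ) (F₁ F₂ : FreqMomentum L M → FreqMomentum L M → ℂ) (F₁₀ : TorusSite 2 L → TorusSite 2 L → ℂ)
    (hsplit : ∀ (p p' : FreqMomentum L M),
      V j t ![((p, 0), 1), ((p', 1), 0), (((omega0 M, y), 0), 0), ((((omega0 M).rev, Qm - x), 1), 1)] *
          V j t ![((p, 0), 0), ((p', 1), 1), ((((omega0 M).rev, Qm - y), 1), 0), (((omega0 M, x), 0), 1)] = c₀ + F₁ p p' + F₂ p p')
    {A₁ L₁ ε₁ : ℝ} (hA1 : 0 ≤ A₁) (hL1 : 0 ≤ L₁) (hε1 : 0 ≤ ε₁)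
    (hY0B₁ : ∀ k : TorusSite 2 L, ‖F₁₀ k (k + (Qm - x - y))‖ ≤ A₁)
    (hY1B₁ : ∀ k k' : TorusSite 2 L, ‖F₁₀ k (k + (Qm - x - y)) - F₁₀ k' (k' + (Qm - x - y))‖ ≤ L₁ * klTorusNorm L (k - k'))
    (hY0A₁ : ∀ k : TorusSite 2 L, ‖F₁₀ (k + -(Qm - x - y)) k‖ ≤ A₁)
    (hY1A₁ : ∀ k k' : TorusSite 2 L, ‖F₁₀ (k + -(Qm - x - y)) k - F₁₀ (k' + -(Qm - x - y)) k'‖ ≤ L₁ * klTorusNorm L (k - k'))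
    (hflat₁ : ∀ (i i' : MatsubaraIdx M) (k k' : TorusSite 2 L), matsubaraInt M i' + 1 = matsubaraInt M i →
      matsubaraFreq β M i ^ 2 ≤ (5 * klScale klE0 (n + 1)) ^ 2 → ‖F₁ (i, k) (i', k') - F₁₀ k k'‖ ≤ ε₁)
    (cen : TorusSite 2 L) {ρw A₂ : ℝ} (hρw : 0 ≤ ρw) (hA2 : 0 ≤ A₂)
    (hF₂ : ∀ (p p' : FreqMomentum L M), ‖F₂ p p'‖ ≤ A₂)
    (hsupp₂ : ∀ (p p' : FreqMomentum L M), ρw < klTorusNorm L (p.2 - cen) → F₂ p p' = 0)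
    (hβL : β ≤ L) {P : SplitConsts} {M4 : ℝ} (hM40 : 0 ≤ M4)
    (hM4 : ∀ X, ‖V j t X‖ ≤ M4) (hM4K : M4 * M4 ≤ 2 ^ 3 * (P.Klam * U) ^ 2)
    (hZS : (524288 / Real.pi * (64 * (klScale klE0 (n + 1) / klScale klE0 j) ^ 2 + (2 * (448 / 3 * Real.exp 2) + 8) + 64) * (Real.pi * Real.sqrt 2 / (B.Dtmin - 4 * A) * (2 * L₁ + 2 * (2 * ‖c₀‖ + A₁) * (2 / (1 / 10))) / (B.Dtmin - 4 * A) + 2 * (2 * ‖c₀‖ + A₁) * (1 / (B.Dtmin - 4 * A) ^ 2 + Real.pi * Real.sqrt 2 * (2 + 4 * A) / (B.Dtmin - 4 * A) ^ 3))) ≤ 2 ^ 52 * (P.Klam * U) ^ 2)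
    (hTHR : (393216 / Real.pi * (64 * (klScale klE0 (n + 1) / klScale klE0 j) ^ 2 + (2 * (448 / 3 * Real.exp 2) + 8) + 64) * (2 * (2 * ‖c₀‖ + A₁) * (Real.pi * Real.sqrt 2 / (B.Dtmin - 4 * A)))) + 2 * (256 / Real.pi * 8 * (2 * (2 * ‖c₀‖ + A₁) * (Real.pi * Real.sqrt 2 / (B.Dtmin - 4 * A))) * (65 * (8 * (16 : ℝ) ^ (j - (n + 1))) + 17408 / 3 * 1)) ≤ 2 ^ 76 * (P.Klam * U) ^ 2)
    (hTR : (256 / Real.pi * 8 * (2 * (2 * ‖c₀‖ + A₁) * (Real.pi * Real.sqrt 2 / (B.Dtmin - 4 * A))) * (65 * (8 * (16 : ℝ) ^ (j - (n + 1))) + 17408 / 3 * 1)) * (4 + 8 / 3 * R.Gfr 1 * U ^ 2) ≤ 2 ^ 52 * (P.Klam * U) ^ 2) :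
    (klScale klE0 n - klScale klE0 (n + 1)) * ((β * (L : ℝ) ^ 2) ^ 3)⁻¹ *
      ‖∑ p : FreqMomentum L M, ∑ p' : FreqMomentum L M,
        if matsubaraInt M p'.1 + matsubaraInt M (omega0 M) + matsubaraInt M (omega0 M) + 1 = matsubaraInt M p.1 ∧ p'.2 = p.2 + Qm - x - y then
          ((((((Φ j t p) : ℝ) : ℂ) * (((β * (L : ℝ) ^ 2 : ℝ) : ℂ) * propCT L M β μ K p)) * ((((Wd t p') : ℝ) : ℂ) * (((β * (L : ℝ) ^ 2 : ℝ) : ℂ) * propCT L M β μ K p'))) +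
              (((((Wd t p) : ℝ) : ℂ) * (((β * (L : ℝ) ^ 2 : ℝ) : ℂ) * propCT L M β μ K p)) * ((((Φ j t p') : ℝ) : ℂ) * (((β * (L : ℝ) ^ 2 : ℝ) : ℂ) * propCT L M β μ K p')))) *
            (V j t ![((p, 0), 1), ((p', 1), 0), (((omega0 M, y), 0), 0), ((((omega0 M).rev, Qm - x), 1), 1)] *
              V j t ![((p, 0), 0), ((p', 1), 1), ((((omega0 M).rev, Qm - y), 1), 0), (((omega0 M, x), 0), 1)])
        else 0‖ ≤
      (P.Klam * U) ^ 2 * klEngGeo11.phGain (n + 1) (klTorusNorm L (x + y - Qm)) + thermalBar klEngGeo11 P U β (n + 1) / 4 +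
        2 * ((96 * (512 * L₁ / klScale klE0 (n + 1) + 32 * (2 * ‖c₀‖ + A₁) * (4 + 8 / 3 * R.Gfr 1 * U ^ 2) * ((9 * (2 * (448 / 3 * Real.exp 2) + 8) + 4 * 8) + (65 * (8 * (16 : ℝ) ^ (j - (n + 1))) + 17408 / 3 * 1)) / klScale klE0 (n + 1) ^ 2)) / L) + ε₁ * (2048 * 15367) +
        A₂ * (4096 * 15381) * (ρw / π + ((L : ℝ))⁻¹) := by
  have hA0 : 0 ≤ 2 * ‖c₀‖ + A₁ := by positivity
  have hLA : 0 ≤ L₁ := hL1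
  have hε : 0 ≤ ε₁ := hε1
  have hβ0 : 0 < β := lt_of_lt_of_le (by norm_num [klBetaMin]) hβ
  have hL : (0 : ℝ) < L := by exact_mod_cast Nat.pos_of_ne_zero (NeZero.ne L)
  have hβL2 : 0 < β * (L : ℝ) ^ 2 := by positivity
  have hΛ1 : 0 < klScale klE0 (n + 1) := klth_klScale_pos (n + 1)
  have hΛj : 0 < klScale klE0 j := klth_klScale_pos j
  have hGfr : 0 ≤ R.Gfr 1 := hR 1
  have h83 : 0 ≤ 8 / 3 * R.Gfr 1 * U ^ 2 := by positivity
  have hG4 : 4 ≤ (4 + 8 / 3 * R.Gfr 1 * U ^ 2) := by linarith only [h83]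
  have hG0 : 0 ≤ (4 + 8 / 3 * R.Gfr 1 * U ^ 2) := by linarith only [h83]
  have hA0' : 0 ≤ A := (norm_nonneg _).trans (hAb 0 0 (by norm_num))
  have hdA : 0 < B.Dtmin - 4 * A := by linarith only [hA]
  set dA : ℝ := B.Dtmin - 4 * A with hdAdef
  have hρeq : klTorusNorm L (x + y - Qm) = klTorusNorm L (Qm - x - y) := by
    rw [show x + y - Qm = -(Qm - x - y) by abel, klTorusNorm_neg]
  have hρ0 : 0 ≤ klTorusNorm L (Qm - x - y) := torusSupNorm_nonneg _
  have hρsmall : klTorusNorm L (Qm - x - y) ≤ klScale klE0 (n + 1) / 32 := by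
    have h4ρ : 4 * klTorusNorm L (Qm - x - y) ≤ (4 + 8 / 3 * R.Gfr 1 * U ^ 2) * klTorusNorm L (Qm - x - y) := mul_le_mul_of_nonneg_right hG4 hρ0
    linarith only [h4ρ, hq]
  have hKl : 0 ≤ (P.Klam * U) ^ 2 := sq_nonneg _
  have ha0 : 0 ≤ klScale klE0 n - klScale klE0 (n + 1) := by linarith only [(klmf_klScale_succ_pos_le n).2]
  have hc0 : 0 ≤ ((β * (L : ℝ) ^ 2) ^ 3)⁻¹ := by positivity
  have hMM : 0 ≤ M4 * M4 := mul_nonneg hM40 hM40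
  -- (1) the signed crossed row (both rows read at the same positive shift)
  have hsig0 := member_crossed_signed_le_split3_two B hR hK hAb hA hA20 hμ n ht hβ hβL hn hβn hM Φ hΦ Wd hWd V hj Qm x y hlo hhi hq c₀ F₁ F₂ F₁₀ hsplit
    hA1 hL1 hε1 hY0B₁ hY1B₁ hY0A₁ hY1A₁ hflat₁ cen hρw hA2 hF₂ hsupp₂
  have eR := klmsRowBound_add B.Dtmin A (4 + 8 / 3 * R.Gfr 1 * U ^ 2) (2 * ‖c₀‖) 0 A₁ L₁ β n j (|2 * π / β| + (4 + 8 / 3 * R.Gfr 1 * U ^ 2) * klTorusNorm L (Qm - x - y)) L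
  rw [zero_add] at eR
  have hW := window_flat_le_base (L := L) β hβ0 n ht hA2 (C := 256 / 3) (by norm_num) hρw
  have habs : |-(2 * π / β)| = |2 * π / β| := abs_neg _
  rw [habs] at hsig0
  -- (2) flat remainder and the running member's soft mass
  have hfl := klmsRoom_flat_le (L := L) (M := M) hβ0 μ K n ht (Φ j t) (C := 256 / 3) hε (by norm_num) (by norm_num)
  have hsm : klSoftMass L M β μ K n (Φ j t) ≤ 15367 := by
    subst hΦ; exact klSoftMass_runningMember_le β μ K hK hβ hβL n hj ht
  -- (3) the exact reading (shift `s = |2π/β|`) and the thermal dictionary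
  have hread := klmsRowBound_reading B.Dtmin A (4 + 8 / 3 * R.Gfr 1 * U ^ 2) (2 * ‖c₀‖ + A₁) L₁ β n j (|2 * π / β| + (4 + 8 / 3 * R.Gfr 1 * U ^ 2) * klTorusNorm L (Qm - x - y)) L
  have hnβ : n ≤ nScales β := by omega
  have hth := klmsRoom_thermal_le hβ hnβ
  have hq4 : ((4 : ℝ) ^ (nScales β - n))⁻¹ ≤ ((4 : ℝ) ^ (nScales β - (n + 1)))⁻¹ :=
    inv_anti₀ (by positivity) (pow_le_pow_right₀ (by norm_num) (by omega))
  have hth' : Real.pi / β / klScale klE0 (n + 1) ≤ 4 * ((4 : ℝ) ^ (nScales β - (n + 1)))⁻¹ := hth.trans (by linarith only [hq4])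
  have hth0 : 0 ≤ Real.pi / β / klScale klE0 (n + 1) := by positivity
  have hs : |2 * π / β| / klScale klE0 (n + 1) = 2 * (Real.pi / β / klScale klE0 (n + 1)) := by
    rw [abs_of_pos (by positivity)]; ring
  have harith := forward_row_arith_shift_quarter (LL := (L : ℝ)) (Lt := (96 * (512 * L₁ / klScale klE0 (n + 1) + 32 * (2 * ‖c₀‖ + A₁) * (4 + 8 / 3 * R.Gfr 1 * U ^ 2) * ((9 * (2 * (448 / 3 * Real.exp 2) + 8) + 4 * 8) + (65 * (8 * (16 : ℝ) ^ (j - (n + 1))) + 17408 / 3 * 1)) / klScale klE0 (n + 1) ^ 2))) (rfl : klScale klE0 (n + 1) = klE0 * ((4 : ℝ) ^ (n + 1))⁻¹) hρ0 hKl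
    (by positivity) hZS (by positivity) (by positivity) hTHR hG0 hTR hth0 (by positivity) hth' two_pow_eighty_le_klEngGeo11_CF hs
  have hTB : klEngGeo11.CF * (P.Klam * U) ^ 2 * ((4 : ℝ) ^ (nScales β - (n + 1)))⁻¹ = thermalBar klEngGeo11 P U β (n + 1) := rfl
  have hTB0 : 0 ≤ thermalBar klEngGeo11 P U β (n + 1) := by
    rw [← hTB]; exact mul_nonneg (mul_nonneg klEngGeo11_CF_nonneg hKl) (by positivity)
  -- (4) the sign-blind factorisation
  have hK4 : ∀ X X', ‖V j t X * V j t X'‖ ≤ M4 * M4 := fun X X' => by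
    rw [norm_mul]; exact mul_le_mul (hM4 X) (hM4 X') (norm_nonneg _) hM40
  have hfac := klmd_sum2_ite_mul_le
    (fun (p : FreqMomentum L M) (p' : FreqMomentum L M) =>
      matsubaraInt M p'.1 + matsubaraInt M (omega0 M) + matsubaraInt M (omega0 M) + 1 = matsubaraInt M p.1 ∧ p'.2 = p.2 + Qm - x - y)
    (fun (p : FreqMomentum L M) (p' : FreqMomentum L M) =>
      ((((((Φ j t p) : ℝ) : ℂ) * (((β * (L : ℝ) ^ 2 : ℝ) : ℂ) * propCT L M β μ K p)) * ((((Wd t p') : ℝ) : ℂ) * (((β * (L : ℝ) ^ 2 : ℝ) : ℂ) * propCT L M β μ K p'))) +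
        (((((Wd t p) : ℝ) : ℂ) * (((β * (L : ℝ) ^ 2 : ℝ) : ℂ) * propCT L M β μ K p)) * ((((Φ j t p') : ℝ) : ℂ) * (((β * (L : ℝ) ^ 2 : ℝ) : ℂ) * propCT L M β μ K p')))))
    (fun (p : FreqMomentum L M) (p' : FreqMomentum L M) =>
      V j t ![((p, 0), 1), ((p', 1), 0), (((omega0 M, y), 0), 0), ((((omega0 M).rev, Qm - x), 1), 1)] *
        V j t ![((p, 0), 0), ((p', 1), 1), ((((omega0 M).rev, Qm - y), 1), 0), (((omega0 M, x), 0), 1)])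
    (fun _ _ _ => hK4 _ _)
  beta_reduce at hfac
  have hmass : (klScale klE0 n - klScale klE0 (n + 1)) * ((β * (L : ℝ) ^ 2) ^ 3)⁻¹ *
      (∑ p : FreqMomentum L M, ∑ p' : FreqMomentum L M,
          (if matsubaraInt M p'.1 + matsubaraInt M (omega0 M) + matsubaraInt M (omega0 M) + 1 = matsubaraInt M p.1 ∧ p'.2 = p.2 + Qm - x - y then
            ‖(((((Φ j t p) : ℝ) : ℂ) * (((β * (L : ℝ) ^ 2 : ℝ) : ℂ) * propCT L M β μ K p)) * ((((Wd t p') : ℝ) : ℂ) * (((β * (L : ℝ) ^ 2 : ℝ) : ℂ) * propCT L M β μ K p'))) +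
              (((((Wd t p) : ℝ) : ℂ) * (((β * (L : ℝ) ^ 2 : ℝ) : ℂ) * propCT L M β μ K p)) * ((((Φ j t p') : ℝ) : ℂ) * (((β * (L : ℝ) ^ 2 : ℝ) : ℂ) * propCT L M β μ K p')))‖
          else 0)) ≤ 2048 * 15367 := by
    have h := (Wx_member_row_flat_le (M := M) β μ K hK hβ hβL n hj ht Qm x y).trans (show (1024 : ℝ) * 15367 ≤ 2048 * 15367 by norm_num)
    simp only [hΦ, hWd]
    exact h
  -- (5) abbreviate and assemble
  set a : ℝ := klScale klE0 n - klScale klE0 (n + 1) with ha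
  set c : ℝ := ((β * (L : ℝ) ^ 2) ^ 3)⁻¹ with hc
  set nS : ℝ := ‖∑ p : FreqMomentum L M, ∑ p' : FreqMomentum L M,
        if matsubaraInt M p'.1 + matsubaraInt M (omega0 M) + matsubaraInt M (omega0 M) + 1 = matsubaraInt M p.1 ∧ p'.2 = p.2 + Qm - x - y then
          ((((((Φ j t p) : ℝ) : ℂ) * (((β * (L : ℝ) ^ 2 : ℝ) : ℂ) * propCT L M β μ K p)) * ((((Wd t p') : ℝ) : ℂ) * (((β * (L : ℝ) ^ 2 : ℝ) : ℂ) * propCT L M β μ K p'))) +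
              (((((Wd t p) : ℝ) : ℂ) * (((β * (L : ℝ) ^ 2 : ℝ) : ℂ) * propCT L M β μ K p)) * ((((Φ j t p') : ℝ) : ℂ) * (((β * (L : ℝ) ^ 2 : ℝ) : ℂ) * propCT L M β μ K p')))) *
            (V j t ![((p, 0), 1), ((p', 1), 0), (((omega0 M, y), 0), 0), ((((omega0 M).rev, Qm - x), 1), 1)] *
              V j t ![((p, 0), 0), ((p', 1), 1), ((((omega0 M).rev, Qm - y), 1), 0), (((omega0 M, x), 0), 1)])
        else 0‖ with hnS
  set Sx : ℝ := ∑ p : FreqMomentum L M, ∑ p' : FreqMomentum L M,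
          (if matsubaraInt M p'.1 + matsubaraInt M (omega0 M) + matsubaraInt M (omega0 M) + 1 = matsubaraInt M p.1 ∧ p'.2 = p.2 + Qm - x - y then
            ‖(((((Φ j t p) : ℝ) : ℂ) * (((β * (L : ℝ) ^ 2 : ℝ) : ℂ) * propCT L M β μ K p)) * ((((Wd t p') : ℝ) : ℂ) * (((β * (L : ℝ) ^ 2 : ℝ) : ℂ) * propCT L M β μ K p'))) +
              (((((Wd t p) : ℝ) : ℂ) * (((β * (L : ℝ) ^ 2 : ℝ) : ℂ) * propCT L M β μ K p)) * ((((Φ j t p') : ℝ) : ℂ) * (((β * (L : ℝ) ^ 2 : ℝ) : ℂ) * propCT L M β μ K p')))‖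
          else 0) with hSx
  set T' : ℝ := thermalBar klEngGeo11 P U β (n + 1) / 4 + 2 * ((96 * (512 * L₁ / klScale klE0 (n + 1) + 32 * (2 * ‖c₀‖ + A₁) * (4 + 8 / 3 * R.Gfr 1 * U ^ 2) * ((9 * (2 * (448 / 3 * Real.exp 2) + 8) + 4 * 8) + (65 * (8 * (16 : ℝ) ^ (j - (n + 1))) + 17408 / 3 * 1)) / klScale klE0 (n + 1) ^ 2)) / L) + ε₁ * (2048 * 15367) +
    A₂ * (4096 * 15381) * (ρw / π + ((L : ℝ))⁻¹) with hT'
  have hT'0 : 0 ≤ T' := by rw [hT']; exact add_nonneg (add_nonneg (add_nonneg (by linarith only [hTB0]) (by positivity)) (by positivity)) (by positivity)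
  have hac : 0 ≤ a * c := mul_nonneg ha0 hc0
  have hb_le : a * c * nS ≤ 2 * (a * klmsRowBound B.Dtmin A (4 + 8 / 3 * R.Gfr 1 * U ^ 2) (2 * ‖c₀‖ + A₁) L₁ β n j (|2 * π / β| + (4 + 8 / 3 * R.Gfr 1 * U ^ 2) * klTorusNorm L (Qm - x - y)) L) + ε₁ * (2048 * 15367) +
      A₂ * (4096 * 15381) * (ρw / π + ((L : ℝ))⁻¹) := by
    have ec : a * c * ((β * (L : ℝ) ^ 2) ^ 2 *
          (β * (L : ℝ) ^ 2 * klmsRowBound B.Dtmin A (4 + 8 / 3 * R.Gfr 1 * U ^ 2) (2 * ‖c₀‖) 0 β n j (|2 * π / β| + (4 + 8 / 3 * R.Gfr 1 * U ^ 2) * klTorusNorm L (Qm - x - y)) L +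
            β * (L : ℝ) ^ 2 * klmsRowBound B.Dtmin A (4 + 8 / 3 * R.Gfr 1 * U ^ 2) (2 * ‖c₀‖) 0 β n j (|2 * π / β| + (4 + 8 / 3 * R.Gfr 1 * U ^ 2) * klTorusNorm L (Qm - x - y)) L)) =
        2 * (a * klmsRowBound B.Dtmin A (4 + 8 / 3 * R.Gfr 1 * U ^ 2) (2 * ‖c₀‖) 0 β n j (|2 * π / β| + (4 + 8 / 3 * R.Gfr 1 * U ^ 2) * klTorusNorm L (Qm - x - y)) L) := by
      rw [hc]; field_simp; ring
    have e1 : a * c * ((β * (L : ℝ) ^ 2) ^ 2 *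
          (β * (L : ℝ) ^ 2 * klmsRowBound B.Dtmin A (4 + 8 / 3 * R.Gfr 1 * U ^ 2) A₁ L₁ β n j (|2 * π / β| + (4 + 8 / 3 * R.Gfr 1 * U ^ 2) * klTorusNorm L (Qm - x - y)) L +
            β * (L : ℝ) ^ 2 * klmsRowBound B.Dtmin A (4 + 8 / 3 * R.Gfr 1 * U ^ 2) A₁ L₁ β n j (|2 * π / β| + (4 + 8 / 3 * R.Gfr 1 * U ^ 2) * klTorusNorm L (Qm - x - y)) L)) =
        2 * (a * klmsRowBound B.Dtmin A (4 + 8 / 3 * R.Gfr 1 * U ^ 2) A₁ L₁ β n j (|2 * π / β| + (4 + 8 / 3 * R.Gfr 1 * U ^ 2) * klTorusNorm L (Qm - x - y)) L) := by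
      rw [hc]; field_simp; ring
    have esum : 2 * (a * klmsRowBound B.Dtmin A (4 + 8 / 3 * R.Gfr 1 * U ^ 2) (2 * ‖c₀‖) 0 β n j (|2 * π / β| + (4 + 8 / 3 * R.Gfr 1 * U ^ 2) * klTorusNorm L (Qm - x - y)) L) + 2 * (a * klmsRowBound B.Dtmin A (4 + 8 / 3 * R.Gfr 1 * U ^ 2) A₁ L₁ β n j (|2 * π / β| + (4 + 8 / 3 * R.Gfr 1 * U ^ 2) * klTorusNorm L (Qm - x - y)) L) =
        2 * (a * klmsRowBound B.Dtmin A (4 + 8 / 3 * R.Gfr 1 * U ^ 2) (2 * ‖c₀‖ + A₁) L₁ β n j (|2 * π / β| + (4 + 8 / 3 * R.Gfr 1 * U ^ 2) * klTorusNorm L (Qm - x - y)) L) := by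
      rw [← eR]; ring
    have h1 := mul_le_mul_of_nonneg_left hsig0 hac
    have h2 : ε₁ * (2048 * klSoftMass L M β μ K n (Φ j t)) ≤ ε₁ * (2048 * 15367) := mul_le_mul_of_nonneg_left (by linarith only [hsm]) hε
    linarith only [h1, ec, e1, esum, hfl, h2, hW]
  have h2 : a * c * nS ≤ (P.Klam * U) ^ 2 * 2 ^ 28 * (2 ^ 24 * ((4 : ℝ) ^ (n + 1))⁻¹ + 2 ^ 24 * klTorusNorm L (Qm - x - y) / klE0 * (4 : ℝ) ^ (n + 1)) + T' := by
    rw [hread] at hb_le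
    rw [hT', ← hTB]
    linarith only [hb_le, harith]
  have h1 : a * c * nS ≤ (P.Klam * U) ^ 2 * 2 ^ 28 + T' := by
    have hmS : a * c * nS ≤ M4 * M4 * (a * c * Sx) := by
      calc a * c * nS ≤ a * c * (M4 * M4 * Sx) := mul_le_mul_of_nonneg_left hfac hac
        _ = M4 * M4 * (a * c * Sx) := by ring
    have h3 : M4 * M4 * (a * c * Sx) ≤ M4 * M4 * (2048 * 15367) := mul_le_mul_of_nonneg_left hmass hMM
    have h4 : M4 * M4 * (2048 * 15367) ≤ 2 ^ 3 * (P.Klam * U) ^ 2 * (2048 * 15367) := mul_le_mul_of_nonneg_right hM4K (by norm_num)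
    have h5 : 2 ^ 3 * (P.Klam * U) ^ 2 * (2048 * 15367) ≤ (P.Klam * U) ^ 2 * 2 ^ 28 := by
      have : (2 : ℝ) ^ 3 * (2048 * 15367) ≤ 2 ^ 28 := by norm_num
      nlinarith only [this, hKl]
    linarith only [hmS, h3, h4, h5, hT'0]
  have h3 : 0 < klTorusNorm L (Qm - x - y) →
      a * c * nS ≤ (P.Klam * U) ^ 2 * 2 ^ 28 * (2 ^ 24 * (klE0 * ((4 : ℝ) ^ (n + 1))⁻¹) / klTorusNorm L (Qm - x - y) +
        2 ^ 24 * Real.sqrt klE0 * ((2 : ℝ) ^ (n + 1))⁻¹) + T' := fun hρ => by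
    have hsc : klE0 * ((4 : ℝ) ^ (n + 1))⁻¹ = klScale klE0 (n + 1) := rfl
    have hA1 : 1 ≤ 2 ^ 24 * (klE0 * ((4 : ℝ) ^ (n + 1))⁻¹) / klTorusNorm L (Qm - x - y) := by
      rw [hsc, one_le_div hρ]; linarith only [hρsmall, hΛ1]
    have hX : (P.Klam * U) ^ 2 * 2 ^ 28 ≤ (P.Klam * U) ^ 2 * 2 ^ 28 *
        (2 ^ 24 * (klE0 * ((4 : ℝ) ^ (n + 1))⁻¹) / klTorusNorm L (Qm - x - y) + 2 ^ 24 * Real.sqrt klE0 * ((2 : ℝ) ^ (n + 1))⁻¹) := by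
      have hA2 : 0 ≤ 2 ^ 24 * Real.sqrt klE0 * ((2 : ℝ) ^ (n + 1))⁻¹ := by positivity
      have h := mul_le_mul_of_nonneg_left (show (1 : ℝ) ≤ 2 ^ 24 * (klE0 * ((4 : ℝ) ^ (n + 1))⁻¹) / klTorusNorm L (Qm - x - y) +
        2 ^ 24 * Real.sqrt klE0 * ((2 : ℝ) ^ (n + 1))⁻¹ by linarith) (by positivity : (0 : ℝ) ≤ (P.Klam * U) ^ 2 * 2 ^ 28)
      rwa [mul_one] at h
    linarith only [h1, hX]
  have hG5 := klg5_phGain_reading (n := n + 1) hρ0 h1 h2 h3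
  have hlift := mul_le_mul_of_nonneg_left (klEngGeo5_phGain_le_klEngGeo11 (n + 1) (klTorusNorm L (Qm - x - y))) hKl
  rw [hT'] at hG5
  rw [hρeq]
  linarith only [hG5, hlift]

end Model

end Summit.HubbardSuperconductivity.HubbardSuperconductivity.Theorems.KLRegimeSplit

end
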